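import Literature.AlgebraicGeometry.HodgeTheory.WeilTypeCMFieldHodgeLieSUOfBlocks
import Literature.AlgebraicGeometry.HodgeTheory.CMHodgeGroupTwoMixedPlacesKWeil
import Literature.AlgebraicGeometry.HodgeTheory.CMFieldOneBalancedPlaceHodgeLie
import HarnessLib

/-!
# `Lie Hg(A) ⊗ ℂ ⊇ (𝔲_E ∩ 𝔰𝔲_K) ⊗ ℂ` for a SIMPLE abelian variety of WEIL TYPE `(3, d)` with `End⁰(A) = E ⊋ K` a QUARTIC CM
# field acting with multiplicity `3`, both places mixed — TABLE X ROW 11 `g6.IV(2,1).kE0` (E biquadratic `= K·E₀`, CM pattern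
# `(2,1)+(1,2)`), EVERY member (Moonen–Zarhin 1998 §4; 1999 (2.3); Ribet 1983)

Family `hodge`, layer `Literature/AlgebraicGeometry/HodgeTheory` (cell `pub-hodgeav-hg6`, req-37 (A) Q2b, TABLE X ROW 11; eng-4 g8,
design note `HOME/jobs/ROW11-Esquare-eng4g8/DESIGN.md`, brick R11-6b — the GEOMETRIC reading of
`CMThetaKWeil.mem_hodgeLieC_of_commute_of_skew_of_trace_twoMixed`, in the VERBATIM shape of the displayed Lie hypothesis `hSU`
of the `E ⊋ K` socket `IsWeilType.mem_hodgeGroupOne_of_mem_unitaryCentralizerGroup_of_cmField_of_hodgeLieC`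
(`WeilTypeCMFieldHodgeGroupUEOfLie`); companion of eng-3 g3's row-13 file `WeilTypeCMFieldOneBalancedPlaceHodgeLie`).
UNCONDITIONAL; theorems only, no definition, no named fact, no `sorry`. HONEST FRAMING of that cell: HC ∕ HC_AV (stmt-1333) ∕
HC_CM (stmt-3052) ∕ H2 NOT proved — a statement about `Lie Hg(A)`.

* **`IsWeilType.mem_hodgeLieC_of_commute_of_skew_of_trace_of_cmField_twoMixed`** — DATA: `(A, φ)` of Weil type `(3, d)`,
  `A` simple, `φ_E ∈ End(A)` with `dim_ℚ End⁰(A) = 2|ι|`, a CM type `μ` of `φ_E^*` with TWO places `k₁ ≠ k₂` covering `ι`,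
  pair multiplicity `3` (`n_{μ k} + n_{μ̄ k} = 3`), BOTH places MIXED (`n_{μ k}, n_{μ̄ k} ≠ 0`), `K`-signature `n_{μ k₁} + n_{μ k₂} = 3`
  (the `(3,3)` along `μ`), and `μ` THE `K`-FIBRE: `W_{μ k} ⊆ W_K = ker(φ^*_ℂ − i√d)`, `W_{μ̄ k} ⊆ W̄_K`. CONCLUSION (`hSU` verbatim,
  for every polarization `ψ` of `H¹(A(ℂ); ℚ)`): every operator on `H¹(A;ℂ)` commuting with `φ^*_ℂ` and `φ_{E,ℂ}^*`, skew for
  `ψ_ℂ` and traceless on `W_K` lies in `Lie Hg(H¹A) ⊗ ℂ`. PROOF: the AV → Hodge dictionary of eng-5 g6 ∕ eng-3 g3 (`End_Hdg =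
  ℚ[φ_E^*]`, division, multiplicities, `htop`), `φ^*` is `ψ`-skew (`CMThetaKWeil.skew_of_apply_eq_neg`), the `W_K`-trace is the
  sum of the two block traces (`IsWeilType.hSU_of_blockTraceLie`), and the Hodge-structure theorem (R11-5).
Plugged into the socket (p698115) it discharges the displayed `hG` of the census rows for EVERY row-11 member (census file
`SixfoldTableXCensusWeilRow11KWeilAllMembers`).

## References
* [MoonenZarhin1998WeilClasses] B. Moonen, Yu. Zarhin, J. reine angew. Math. 496 (1998), §4 Remark (1).
* [MoonenZarhin1999LowDim] B. Moonen, Yu. Zarhin, Math. Ann. 315 (1999), §2 (2.3), (1.9).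
* [Ribet1983] K. A. Ribet, Amer. J. Math. 105 (1983), Thm. 0, §3.
* [vanGeemen1994HodgeAV] B. van Geemen, LNM 1594 (1994), 4.9 and 6.9.
* [MumfordAV1970] D. Mumford, Abelian varieties (1970), §19 Cor. 2 of Thm. 1 (p. 174).
-/

noncomputable section

open scoped TensorProduct Matrix
open CategoryTheory Module

namespace Literature.AlgebraicGeometry.HodgeTheory

open Literature.AlgebraicTopology.SingularHomology
open Literature.AlgebraicGeometry.Motives (IsSmoothProjective AbelianVariety bettiCohomology HodgeTensorFacts hodgeTensorFacts_holds)
open Literature.AlgebraicGeometry.Motives.HodgeStructure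
open Literature.AlgebraicGeometry.ComplexMultiplication (bettiRep bettiRep_of)

variable {A : AbelianVariety ℂ} {φ : A ⟶ A} {d : ℕ} {ι : Type} [Fintype ι] [DecidableEq ι]

/-- The two elements of `Fin 2`. [folklore] -/
private theorem fin2_cases₇ (r : Fin 2) : r = 0 ∨ r = 1 := by
  fin_cases r <;> simp

/-- **`Lie Hg(H¹A) ⊗ ℂ ⊇ (𝔲_E ∩ 𝔰𝔲_K) ⊗ ℂ` FOR EVERY ROW-11 MEMBER** (see the module docstring): the displayed Lie hypothesis
`hSU` of the cell's `E ⊋ K` socket is a THEOREM for a simple `(A, φ)` of Weil type `(3, d)` with `End⁰(A) = E` a quartic CM field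
(`dim_ℚ = 2|ι|`, `|ι| = 2`), CM type `μ` = the `K`-fibre, pair multiplicity `3`, both places mixed, `K`-signature `3` along `μ`.
[cite: MoonenZarhin1998WeilClasses, §4 Remark (1)] [cite: MoonenZarhin1999LowDim, §2 (2.3)] [cite: Ribet1983, Thm. 0]
[cite: vanGeemen1994HodgeAV, 4.9] [cite: MumfordAV1970, §19 Cor. 2 of Thm. 1 (p. 174)] -/
theorem IsWeilType.mem_hodgeLieC_of_commute_of_skew_of_trace_of_cmField_twoMixed [HodgeTensorFacts.{0, 0}]
    (hW : IsWeilType A φ 3 d) (hAs : A.IsSimple) (φE : A ⟶ A) (hE : Module.finrank ℚ A.endAlgebra = 2 * Fintype.card ι)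
    (μ : ι → ℂ) (hinj : Function.Injective μ) (hdist : ∀ k k', μ k' ≠ starRingEnd ℂ (μ k))
    (hmult : ∀ k, eigenMultiplicity A φE (μ k) + eigenMultiplicity A φE (starRingEnd ℂ (μ k)) = 3)
    (hmixed : ∀ k, eigenMultiplicity A φE (μ k) ≠ 0 ∧ eigenMultiplicity A φE (starRingEnd ℂ (μ k)) ≠ 0)
    (k₁ k₂ : ι) (hk : k₁ ≠ k₂) (hι : ∀ k, k = k₁ ∨ k = k₂)
    (hKW : eigenMultiplicity A φE (μ k₁) + eigenMultiplicity A φE (μ k₂) = 3)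
    (hKE : ∀ k, Module.End.eigenspace (((bettiCohomology.map φE.hom.hom.hom 1).hom).baseChange ℂ) (μ k) ≤
      Module.End.eigenspace (((bettiCohomology.map φ.hom.hom.hom 1).hom).baseChange ℂ) (Complex.I * (Real.sqrt d : ℂ)))
    (hKE' : ∀ k, Module.End.eigenspace (((bettiCohomology.map φE.hom.hom.hom 1).hom).baseChange ℂ) (starRingEnd ℂ (μ k)) ≤
      Module.End.eigenspace (((bettiCohomology.map φ.hom.hom.hom 1).hom).baseChange ℂ) (-(Complex.I * (Real.sqrt d : ℂ))))
    (ψ : (BettiUniverse.hodge exists_isReal_hodgeModel_holds (AbelianVariety.isSmoothProjective_holds (A := A)) 1).Polarization) :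
    ∀ (Y : Module.End ℂ (ℂ ⊗[ℚ] bettiCohomology A.X 1))
      (hYφ : Y * ((bettiCohomology.map φ.hom.hom.hom 1).hom).baseChange ℂ =
        ((bettiCohomology.map φ.hom.hom.hom 1).hom).baseChange ℂ * Y),
      Y * ((bettiCohomology.map φE.hom.hom.hom 1).hom).baseChange ℂ =
        ((bettiCohomology.map φE.hom.hom.hom 1).hom).baseChange ℂ * Y →
      (∀ x y, ψ.form.baseChange ℂ (Y x) y + ψ.form.baseChange ℂ x (Y y) = 0) →
      LinearMap.trace ℂ _ (Y.restrict fun x (hx : x ∈ Module.End.eigenspace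
          (((bettiCohomology.map φ.hom.hom.hom 1).hom).baseChange ℂ) (Complex.I * (Real.sqrt d : ℂ))) =>
        UnitaryTheta.apply_mem_eigenspace_of_commute hYφ hx) = 0 →
      Y ∈ (BettiUniverse.hodge exists_isReal_hodgeModel_holds (AbelianVariety.isSmoothProjective_holds (A := A)) 1).hodgeLieC := by
  classical
  have hHD : exists_isReal_hodgeModel := exists_isReal_hodgeModel_holds
  have hI : hodgePQ_independent_of_hodgeModel := hodgePQ_independent_of_hodgeModel_holds
  haveI : Module.Finite ℚ (bettiCohomology A.X 1) := finite_bettiCohomology_one A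
  have hX : IsSmoothProjective A.dim A.X := AbelianVariety.isSmoothProjective_holds
  have heff := BettiUniverse.hodge_isEffective hHD hX 1
  -- `|ι| = 2`, `dim A = 6 = |ι| · 3`
  have hcard2 : Fintype.card ι = 2 := by
    have huniv : (Finset.univ : Finset ι) = {k₁, k₂} := by
      ext k
      simp only [Finset.mem_univ, Finset.mem_insert, Finset.mem_singleton, true_iff]
      exact hι k
    rw [← Finset.card_univ, huniv, Finset.card_insert_of_notMem (by rw [Finset.mem_singleton]; exact hk),
      Finset.card_singleton]
  have hdim : A.dim = Fintype.card ι * 3 := by rw [hW.dim_eq, hcard2]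
  -- reduce `hSU` to the two-block statement
  refine hW.hSU_of_blockTraceLie φE hE μ hinj hdist (by norm_num : 0 < 3) hmult hdim hKE hKE' ψ k₁ k₂ hk hι ?_
  intro Y hYφE hYskew hYtr
  -- the rational data `φ_E^*_ℚ` (the CM generator) and `φ^*_ℚ` (the `K`-operator)
  set φQ : Module.End ℚ (bettiCohomology A.X 1) := (bettiCohomology.map φE.hom.hom.hom 1).hom with hφQ
  set φK : Module.End ℚ (bettiCohomology A.X 1) := (bettiCohomology.map φ.hom.hom.hom 1).hom with hφK
  set μK : ℂ := Complex.I * (Real.sqrt d : ℂ) with hμKdef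
  have hμK0 : μK ≠ 0 := mul_ne_zero Complex.I_ne_zero
    (Complex.ofReal_ne_zero.2 (Real.sqrt_ne_zero'.2 (Nat.cast_pos.2 hW.d_pos)))
  have hφE' : φQ ∈ (BettiUniverse.hodge hHD (AbelianVariety.isSmoothProjective_holds (A := A)) 1).endAlg := by
    have h := unop_bettiRep_mem_endAlg hHD hI (AbelianVariety.endAlgebra.of A φE)
    rwa [bettiRep_of, MulOpposite.unop_op] at h
  have hφKE : φK ∈ (BettiUniverse.hodge hHD (AbelianVariety.isSmoothProjective_holds (A := A)) 1).endAlg := by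
    have h := unop_bettiRep_mem_endAlg hHD hI (AbelianVariety.endAlgebra.of A φ)
    rwa [bettiRep_of, MulOpposite.unop_op] at h
  have hVC : Module.finrank ℂ (ℂ ⊗[ℚ] bettiCohomology A.X 1) = Fintype.card (ι × Fin 2) * 3 := by
    rw [Module.finrank_baseChange, finrank_bettiCohomology_one A, hdim, Fintype.card_prod, Fintype.card_fin]; ring
  -- the `2|ι|` eigenvalues, pairwise distinct
  set ev : ι × Fin 2 → ℂ := fun kt => if kt.2 = 0 then μ kt.1 else starRingEnd ℂ (μ kt.1) with hevdef
  have hev0 : ∀ k, ev (k, 0) = μ k := fun k => by simp [hevdef]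
  have hev1 : ∀ k, ev (k, 1) = starRingEnd ℂ (μ k) := fun k => by simp [hevdef]
  have hev : Function.Injective ev := by
    rintro ⟨k, t⟩ ⟨k', t'⟩ h
    rcases fin2_cases₇ t with rfl | rfl <;> rcases fin2_cases₇ t' with rfl | rfl
    · rw [hev0, hev0] at h; rw [hinj h]
    · rw [hev0, hev1] at h; exact absurd h (hdist k' k)
    · rw [hev1, hev0] at h; exact absurd h.symm (hdist k k')
    · rw [hev1, hev1] at h; rw [hinj ((starRingEnd ℂ).injective h)]
  -- the multiplicity dictionary
  have hgr := fun cc => CMTheta.finrank_eigenspace_eq_add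
    (BettiUniverse.hodge hHD (AbelianVariety.isSmoothProjective_holds (A := A)) 1) Nat.cast_one heff hφE' cc
  have h10 : ∀ cc, Module.finrank ℂ ↥(Module.End.eigenspace (φQ.baseChange ℂ) cc ⊓
      (BettiUniverse.hodge hHD (AbelianVariety.isSmoothProjective_holds (A := A)) 1).piece 1 0) =
        eigenMultiplicity A φE cc := fun cc => by
    rw [hφQ, finrank_eigenspace_inf_piece_oneZero_eq_eigenMultiplicity hHD hI φE cc]
  have h01 : ∀ cc, Module.finrank ℂ ↥(Module.End.eigenspace (φQ.baseChange ℂ) cc ⊓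
      (BettiUniverse.hodge hHD (AbelianVariety.isSmoothProjective_holds (A := A)) 1).piece 0 1) =
        eigenMultiplicity A φE (starRingEnd ℂ cc) := fun cc => by
    rw [hφQ, finrank_eigenspace_inf_piece_zeroOne_eq_eigenMultiplicity_conj hHD hI φE cc]
  have hfin : ∀ kt, Module.finrank ℂ ↥(Module.End.eigenspace (φQ.baseChange ℂ) (ev kt)) = 3 := by
    rintro ⟨k, t⟩
    rw [hgr, h10, h01]
    rcases fin2_cases₇ t with rfl | rfl
    · rw [hev0]; exact hmult k
    · rw [hev1, starRingEnd_self_apply, add_comm]; exact hmult k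
  have hWne : ∀ kt, Module.End.eigenspace (φQ.baseChange ℂ) (ev kt) ≠ ⊥ := by
    intro kt hkt
    have h := hfin kt
    rw [hkt, finrank_bot] at h
    omega
  -- `End_Hdg = ℚ[φ_E^*]`
  have hcard : Fintype.card (ι × Fin 2) = 2 * Fintype.card ι := by rw [Fintype.card_prod, Fintype.card_fin, mul_comm]
  set e : ι × Fin 2 ≃ Fin (2 * Fintype.card ι) := Fintype.equivFinOfCardEq hcard with hedef
  have hEφ := exists_eq_sum_smul_pow_bettiMapHom_fin hHD hI φE hE (ev ∘ e.symm) (hev.comp e.symm.injective)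
    fun j => hWne (e.symm j)
  -- `hrank`, `htop`
  have hrank : ∀ k, Module.finrank ℂ ↥(Module.End.eigenspace (φQ.baseChange ℂ) (μ k) ⊓
      (BettiUniverse.hodge hHD (AbelianVariety.isSmoothProjective_holds (A := A)) 1).piece 1 0) +
      Module.finrank ℂ ↥(Module.End.eigenspace (φQ.baseChange ℂ) (μ k) ⊓
      (BettiUniverse.hodge hHD (AbelianVariety.isSmoothProjective_holds (A := A)) 1).piece 0 1) = 3 := fun k => by
    rw [h10, h01]; exact hmult k
  have htop : (⨆ kt : ι × Fin 2, Module.End.eigenspace (φQ.baseChange ℂ) (ev kt)) = ⊤ := by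
    have hind : iSupIndep fun kt => Module.End.eigenspace (φQ.baseChange ℂ) (ev kt) :=
      (Module.End.eigenspaces_iSupIndep (φQ.baseChange ℂ)).comp hev
    apply Submodule.eq_top_of_finrank_eq
    have h := Motives.finrank_biSup_eq_sum_of_iSupIndep hind Finset.univ
    have hs : (⨆ kt ∈ (Finset.univ : Finset (ι × Fin 2)), Module.End.eigenspace (φQ.baseChange ℂ) (ev kt)) =
        ⨆ kt, Module.End.eigenspace (φQ.baseChange ℂ) (ev kt) := by simp
    rw [hs] at h
    rw [h, hVC, Finset.sum_congr rfl fun kt _ => hfin kt, Finset.sum_const, Finset.card_univ, smul_eq_mul]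
  -- `dim_ℚ End_Hdg = 2|ι|` and the division property (`A` simple)
  have hEdim : Module.finrank ℚ (BettiUniverse.hodge hHD (AbelianVariety.isSmoothProjective_holds (A := A)) 1).endAlg =
      2 * Fintype.card ι := by
    rw [finrank_endAlg_hodge_one hHD hI, hE]
  have hdiv : ∀ a ∈ (BettiUniverse.hodge hHD (AbelianVariety.isSmoothProjective_holds (A := A)) 1).endAlg, a ≠ 0 →
      ∃ b : Module.End ℚ (bettiCohomology A.X 1), b * a = 1 := by
    intro a ha ha0
    set x := (endAlgebraOpAlgEquivEndAlg (B := A) hHD hI).symm ⟨a, ha⟩ with hxdef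
    have hx : ((endAlgebraOpAlgEquivEndAlg (B := A) hHD hI x :
        (BettiUniverse.hodge hHD (AbelianVariety.isSmoothProjective_holds (A := A)) 1).endAlg) :
        Module.End ℚ (bettiCohomology A.X 1)) = a := by
      rw [hxdef, AlgEquiv.apply_symm_apply]
    have hx0 : MulOpposite.unop x ≠ 0 := by
      intro h0
      have : x = 0 := MulOpposite.unop_injective (by rw [h0, MulOpposite.unop_zero])
      apply ha0
      rw [← hx, this, map_zero]
      rfl
    obtain ⟨y, hxy, -⟩ :=
      Literature.AlgebraicGeometry.ComplexMultiplication.endAlgebra_exists_inv_of_isSimple hAs (MulOpposite.unop x) hx0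
    refine ⟨((endAlgebraOpAlgEquivEndAlg (B := A) hHD hI (MulOpposite.op y) :
      (BettiUniverse.hodge hHD (AbelianVariety.isSmoothProjective_holds (A := A)) 1).endAlg) :
      Module.End ℚ (bettiCohomology A.X 1)), ?_⟩
    rw [← hx, ← Subalgebra.coe_mul, ← map_mul, ← MulOpposite.op_unop x, ← MulOpposite.op_mul, hxy,
      MulOpposite.op_one, map_one, Subalgebra.coe_one]
  -- the pattern, in the Hodge dictionary
  have hmixed' : ∀ k, Module.finrank ℂ ↥(Module.End.eigenspace (φQ.baseChange ℂ) (μ k) ⊓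
      (BettiUniverse.hodge hHD (AbelianVariety.isSmoothProjective_holds (A := A)) 1).piece 1 0) ≠ 0 ∧
      Module.finrank ℂ ↥(Module.End.eigenspace (φQ.baseChange ℂ) (μ k) ⊓
      (BettiUniverse.hodge hHD (AbelianVariety.isSmoothProjective_holds (A := A)) 1).piece 0 1) ≠ 0 := fun k => by
    rw [h10, h01]; exact hmixed k
  have hbal : ((Module.finrank ℂ ↥(Module.End.eigenspace (φQ.baseChange ℂ) (μ k₁) ⊓
      (BettiUniverse.hodge hHD (AbelianVariety.isSmoothProjective_holds (A := A)) 1).piece 1 0) : ℤ) -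
      Module.finrank ℂ ↥(Module.End.eigenspace (φQ.baseChange ℂ) (μ k₁) ⊓
      (BettiUniverse.hodge hHD (AbelianVariety.isSmoothProjective_holds (A := A)) 1).piece 0 1)) +
      ((Module.finrank ℂ ↥(Module.End.eigenspace (φQ.baseChange ℂ) (μ k₂) ⊓
      (BettiUniverse.hodge hHD (AbelianVariety.isSmoothProjective_holds (A := A)) 1).piece 1 0) : ℤ) -
      Module.finrank ℂ ↥(Module.End.eigenspace (φQ.baseChange ℂ) (μ k₂) ⊓
      (BettiUniverse.hodge hHD (AbelianVariety.isSmoothProjective_holds (A := A)) 1).piece 0 1)) = 0 := by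
    rw [h10, h01, h10, h01]
    have h1 := hmult k₁; have h2 := hmult k₂
    omega
  -- the `K`-datum on the blocks: `φ^*_ℂ = ±i√d` on `W_{μ k}` ∕ `W_{μ̄ k}`, hence `φ^*` is `ψ`-skew
  have hKEv : ∀ k, ∀ w ∈ Module.End.eigenspace (φQ.baseChange ℂ) (μ k), φK.baseChange ℂ w = μK • w := fun k w hw =>
    Module.End.mem_eigenspace_iff.1 (hKE k hw)
  have hKE'v : ∀ k, ∀ w ∈ Module.End.eigenspace (φQ.baseChange ℂ) (starRingEnd ℂ (μ k)), φK.baseChange ℂ w = -(μK • w) :=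
    fun k w hw => by rw [← neg_smul]; exact Module.End.mem_eigenspace_iff.1 (hKE' k hw)
  have hKskew : ∀ v w, ψ.form (φK v) w + ψ.form v (φK w) = 0 :=
    CMThetaKWeil.skew_of_apply_eq_neg (BettiUniverse.hodge hHD (AbelianVariety.isSmoothProjective_holds (A := A)) 1) Nat.cast_one
      heff ψ hφE' hEφ μ hinj hdist htop (fun _ => μK) hKEv hKE'v
  -- the Hodge-structure theorem
  exact CMThetaKWeil.mem_hodgeLieC_of_commute_of_skew_of_trace_twoMixed
    (BettiUniverse.hodge hHD (AbelianVariety.isSmoothProjective_holds (A := A)) 1) Nat.cast_one heff ψ hφE' hEφ hEdim hdiv μ hinj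
    hdist hrank htop hφKE hKskew hμK0 hKEv hmixed' k₁ k₂ hk hι hbal hYφE hYskew hYtr

end Literature.AlgebraicGeometry.HodgeTheory

end
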